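import Summits.HodgeConjecture.CorCM.LefschetzAlgebraQuaternionCentre
import Summits.HodgeConjecture.CorCM.LefschetzAlgebraTotallyRealField
import Literature.Algebra.Lie.UnitaryCentralizerSkewDimension
import HarnessLib

/-!
# Type IV with commutative multiplication: `2 · dim Lef(ψ) = dim C(End_Hdg(H¹B))` (the unitary Lefschetz Lie algebra)

Sub-problem `CorCM` of `HodgeConjecture` (cell `pub-hodgecm2`, count-neutral Mumford–Tate-rank lane of seat `b27`; theorems only,
no new definition, no named fact; nothing here uses or asserts `HC_CM`).  The lane's first TYPE IV statement.  Let the endomorphism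
algebra of the complex abelian variety `B` be `End⁰B = K₀ ⊕ K₀ ι` with `K₀` a totally real number field of degree `e₀` acting
through a `K₀`-algebra structure, `ι² = a ∈ K₀×`, and let `ψ` be a polarization of `H¹(B, ℚ)` whose Rosati involution FIXES `K₀`
and NEGATES `ι` (Albert type IV(e₀, d = 1): `End⁰B = K = K₀(ι)` a CM field, Rosati = complex conjugation).  Then

  **`2 · dim_ℚ Lef(ψ) = dim_ℚ C(End_Hdg(H¹B))`**, `Lef(ψ) = C(End_Hdg(H¹B)) ∩ 𝔰𝔭(ψ)`

(`two_mul_finrank_lefschetz_eq_finrank_centralizer_of_cmCentre`; hence `2 · dim Lie Hg(H¹B) ≤ dim C(End_Hdg)`,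
`two_mul_finrank_hodgeLie_le_finrank_centralizer_of_cmCentre`): `Lef(ψ)` is the restriction of scalars of the unitary Lie
algebra `𝔲(H¹B / K, φ)` of the hermitian form with `ψ = Tr(f φ)`, of `K₀`-dimension `m²` (`m = dim_K H¹B = g/e₀`), while
`C(End_Hdg) = Res_{K/ℚ} End_K(H¹B)` has dimension `2 e₀ m²` — Milne's `C(A) = S(A) = U(φ)` for type IV with `d = 1`.

METHOD.  `H¹B` is a `K₀`-space through `bettiRep`; `ψ` is `K₀`-balanced (Rosati fixes `K₀`) and descends along the trace,
`ψ = Tr_{K₀/ℚ} ∘ ψ_{K₀}` (`LinearAlgebra/QuadraticForm/TraceFormDescent`); `ι` acts `K₀`-linearly, `ψ_{K₀}`-skew, `ι² = a`;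
restriction of scalars identifies `Lef(ψ)` with `C_{K₀}(ι) ∩ 𝔰𝔭(ψ_{K₀})` and `C(End_Hdg)` with `C_{K₀}(ι)` (`End_Hdg = ρ(End⁰B)`,
`exists_unop_bettiRep_eq_of_mem_endAlg`, and `End⁰B = K₀ ⊕ K₀ι`), and `2 · dim_{K₀}(C_{K₀}(ι) ∩ 𝔰𝔭) = dim_{K₀} C_{K₀}(ι)`
(`Algebra/Lie/UnitaryCentralizerSkewDimension`: left multiplication by `ι` exchanges the symmetric and skew parts of `C(ι)`).

## References
* [Milne1999LefschetzClasses] J. S. Milne, *Lefschetz classes on abelian varieties*, Duke Math. J. 96 (1999), §2 (type IV) and Summary.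
* [MoonenZarhin1999LowDim] B. Moonen, Yu. G. Zarhin, *Hodge classes on abelian varieties of low dimension*, Math. Ann. 315 (1999), §1
  (`Hg ⊆ U_F` for type IV), (2.2) type IV(2,1), (2.4).
* [Murty1984ExceptionalHodgeClasses] V. K. Murty, *Exceptional Hodge classes on certain abelian varieties*, Math. Ann. 268 (1984), §2–3.
-/

noncomputable section

namespace Summit.HodgeConjecture.CorCM

open scoped TensorProduct
open CategoryTheory CategoryTheory.Limits Module NumberField
open Literature.AlgebraicGeometry.Motives
open Literature.AlgebraicGeometry.Motives.AbelianVariety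
open Literature.AlgebraicGeometry.Motives.HodgeStructure
open Literature.AlgebraicGeometry.HodgeTheory
open Literature.AlgebraicGeometry.ComplexMultiplication (bettiRep bettiRep_injective)
open Literature.RingTheory.CentralSimple
open Literature.Algebra.Lie
open Literature.LinearAlgebra.QuadraticForm

/-- **The unitary Lefschetz Lie algebra (type IV, `d = 1`).**  `End⁰B ⊇ K₀ ⊕ K₀ι = End⁰B` with `K₀` totally real acting as a
`K₀`-algebra structure, `ι² = a ≠ 0` in `K₀`, and a polarization `ψ` whose Rosati involution fixes `K₀` and negates `ι`:
**`2 · dim_ℚ (C(End_Hdg(H¹B)) ∩ 𝔰𝔭(ψ)) = dim_ℚ C(End_Hdg(H¹B))`.** [cite: Milne1999LefschetzClasses, §2 and Summary]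
[cite: MoonenZarhin1999LowDim, §1] -/
theorem two_mul_finrank_lefschetz_eq_finrank_centralizer_of_cmCentre {B : AbelianVariety ℂ} {K : Type} [Field K] [NumberField K]
    [IsTotallyReal K] [Algebra K B.endAlgebra] [IsScalarTower ℚ K B.endAlgebra] [Module.Finite ℚ (bettiCohomology B.X 1)]
    (ψ : (BettiUniverse.hodge exists_isReal_hodgeModel_holds (AbelianVariety.isSmoothProjective_holds (A := B)) 1).Polarization)
    {ι : B.endAlgebra} {a : K} (ha : a ≠ 0) (hι : ι * ι = algebraMap K B.endAlgebra a)
    (hgen : ∀ z : B.endAlgebra, ∃ c d : K, z = algebraMap K _ c + algebraMap K _ d * ι)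
    (hrosK : ∀ c : K, AbelianVariety.rosati B exists_isReal_hodgeModel_holds hodgePQ_independent_of_hodgeModel_holds ψ
      (algebraMap K _ c) = algebraMap K _ c)
    (hrosι : AbelianVariety.rosati B exists_isReal_hodgeModel_holds hodgePQ_independent_of_hodgeModel_holds ψ ι = -ι) :
    2 * Module.finrank ℚ ↥(Subalgebra.toSubmodule (Subalgebra.centralizer ℚ
          ((BettiUniverse.hodge exists_isReal_hodgeModel_holds (AbelianVariety.isSmoothProjective_holds (A := B)) 1).endAlg :
            Set (Module.End ℚ (bettiCohomology B.X 1)))) ⊓ ψ.form.skewAdjointSubmodule) =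
      Module.finrank ℚ ↥(Subalgebra.toSubmodule (Subalgebra.centralizer ℚ
          ((BettiUniverse.hodge exists_isReal_hodgeModel_holds (AbelianVariety.isSmoothProjective_holds (A := B)) 1).endAlg :
            Set (Module.End ℚ (bettiCohomology B.X 1))))) := by
  classical
  have hHD : exists_isReal_hodgeModel := exists_isReal_hodgeModel_holds
  have hI : hodgePQ_independent_of_hodgeModel := hodgePQ_independent_of_hodgeModel_holds
  have hX : IsSmoothProjective B.dim B.X := AbelianVariety.isSmoothProjective_holds
  -- `ρ = unop ∘ bettiRep`, Riemann's anti-isomorphism onto `End_Hdg(H¹B)`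
  let ρ : B.endAlgebra → Module.End ℚ (bettiCohomology B.X 1) := fun z => MulOpposite.unop (bettiRep B z)
  have hρ : ∀ z, ρ z = MulOpposite.unop (bettiRep B z) := fun z => rfl
  have hρmul : ∀ z w, ρ (z * w) = ρ w * ρ z := fun z w => by rw [hρ, hρ, hρ, map_mul, MulOpposite.unop_mul]
  have hρadd : ∀ z w, ρ (z + w) = ρ z + ρ w := fun z w => by rw [hρ, hρ, hρ, map_add, MulOpposite.unop_add]
  have hρneg : ∀ z, ρ (-z) = -ρ z := fun z => by rw [hρ, hρ, map_neg, MulOpposite.unop_neg]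
  have hρzero : ρ 0 = 0 := by rw [hρ, map_zero, MulOpposite.unop_zero]
  have hρone : ρ 1 = 1 := by rw [hρ, map_one, MulOpposite.unop_one]
  have hρrat : ∀ r : ℚ, ρ (algebraMap ℚ B.endAlgebra r) = r • (1 : Module.End ℚ (bettiCohomology B.X 1)) := fun r => by
    rw [hρ, AlgHom.commutes, MulOpposite.algebraMap_apply, MulOpposite.unop_op, Algebra.algebraMap_eq_smul_one]
  have hρA : ∀ z, ρ z ∈ (BettiUniverse.hodge exists_isReal_hodgeModel_holds (AbelianVariety.isSmoothProjective_holds (A := B)) 1).endAlg := fun z =>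
    Literature.AlgebraicGeometry.ComplexMultiplication.unop_bettiRep_mem_endAlg hHD hI z
  have hτρ : ∀ z, ψ.adjoint (ρ z) =
      ρ (AbelianVariety.rosati B exists_isReal_hodgeModel_holds hodgePQ_independent_of_hodgeModel_holds ψ z) :=
    fun z => (AbelianVariety.unop_bettiRep_rosati hHD hI ψ z).symm
  obtain ⟨Lef, hLef⟩ : ∃ Lef : Submodule ℚ (Module.End ℚ (bettiCohomology B.X 1)), Lef =
      Subalgebra.toSubmodule (Subalgebra.centralizer ℚ
        ((BettiUniverse.hodge exists_isReal_hodgeModel_holds (AbelianVariety.isSmoothProjective_holds (A := B)) 1).endAlg :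
          Set (Module.End ℚ (bettiCohomology B.X 1)))) ⊓ ψ.form.skewAdjointSubmodule := ⟨_, rfl⟩
  have hmemLef : ∀ {Y : Module.End ℚ (bettiCohomology B.X 1)}, Y ∈ Lef ↔
      (∀ g ∈ (BettiUniverse.hodge exists_isReal_hodgeModel_holds (AbelianVariety.isSmoothProjective_holds (A := B)) 1).endAlg,
        g * Y = Y * g) ∧ ∀ x y, ψ.form (Y x) y = -ψ.form x (Y y) := fun {Y} => by
    rw [hLef, Submodule.mem_inf, Subalgebra.mem_toSubmodule, Subalgebra.mem_centralizer_iff, LinearMap.mem_skewAdjointSubmodule]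
    refine and_congr_right fun _ => forall_congr' fun x => forall_congr' fun y => ?_
    rw [Pi.neg_apply, map_neg]
  rw [← hLef]
  -- the centre `K` acts by Rosati-fixed endomorphisms commuting with `ρ(End⁰B)`
  have hcenK : ∀ (c : K) (z : B.endAlgebra), ρ (algebraMap K _ c) * ρ z = ρ z * ρ (algebraMap K _ c) := fun c z => by
    rw [← hρmul, ← hρmul, Algebra.commutes]
  -- `H¹B` as a `K`-vector space
  let f : K →+* Module.End ℚ (bettiCohomology B.X 1) :=
    { toFun := fun c => ρ (algebraMap K _ c)
      map_one' := by rw [map_one, hρone]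
      map_mul' := fun c c' => by rw [mul_comm c c', map_mul, hρmul]
      map_zero' := by rw [map_zero, hρzero]
      map_add' := fun c c' => by rw [map_add, hρadd] }
  letI : Module K (bettiCohomology B.X 1) := Module.compHom _ f
  have hsmulK : ∀ (c : K) (x : bettiCohomology B.X 1), c • x = ρ (algebraMap K _ c) x := fun c x => rfl
  haveI : IsScalarTower ℚ K (bettiCohomology B.X 1) := ⟨fun q c x => by
    rw [hsmulK, hsmulK, Algebra.smul_def, map_mul, ← IsScalarTower.algebraMap_apply ℚ K B.endAlgebra q, hρmul, hρrat,
      Module.End.mul_apply, LinearMap.smul_apply, Module.End.one_apply, map_smul]⟩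
  haveI : Module.Finite K (bettiCohomology B.X 1) := Module.Finite.of_restrictScalars_finite ℚ K _
  -- `ψ` is `K`-balanced (Rosati fixes the centre) and descends along the trace
  have hbal : ∀ (c : K) (x y : bettiCohomology B.X 1), ψ.form (c • x) y = ψ.form x (c • y) := fun c x y => by
    rw [hsmulK, hsmulK, ← ψ.form_apply_adjoint (ρ (algebraMap K _ c)) x y, hτρ, hrosK]
  obtain ⟨ψK, hψK⟩ := TraceFormDescent.exists_forall_trace_mul_eq (k := ℚ) ψ.form hbal
  have hψanti : ∀ x y : bettiCohomology B.X 1, ψ.form y x = -ψ.form x y := fun x y => by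
    have h := LinearMap.congr_fun₂ ψ.flip_form x y
    rw [show (((1 : ℕ) : ℤ).negOnePow : ℤˣ) = -1 from Int.negOnePow_one, Units.val_neg, Units.val_one, neg_one_zsmul] at h
    simpa only [LinearMap.BilinForm.flip_apply, LinearMap.neg_apply] using h
  have hψKanti : ∀ x y, ψK y x = -ψK x y := (TraceFormDescent.flip_eq_neg_iff_of_trace hψK hbal).1 hψanti
  have hψKflip : ψK.flip = -ψK := LinearMap.ext fun x => LinearMap.ext fun y => by
    rw [LinearMap.BilinForm.flip_apply, LinearMap.neg_apply, LinearMap.neg_apply, hψKanti]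
  have hψKL : ∀ x, (∀ y, ψK x y = 0) → x = 0 := TraceFormDescent.separatingLeft_of_trace hψK ψ.nondegenerate.1
  have hψKnd : ψK.Nondegenerate := ⟨hψKL, fun y hy => hψKL y fun x => by rw [hψKanti, hy x, neg_zero]⟩
  -- elements of `End⁰B` act `K`-linearly: `ρK z`
  have hρK : ∀ z : B.endAlgebra, ∃ T : bettiCohomology B.X 1 →ₗ[K] bettiCohomology B.X 1, ∀ x, T x = ρ z x := fun z =>
    ⟨{ toFun := ρ z, map_add' := map_add (ρ z), map_smul' := fun c x => by
        rw [RingHom.id_apply, hsmulK, hsmulK, ← Module.End.mul_apply, ← hcenK, Module.End.mul_apply] }, fun x => rfl⟩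
  obtain ⟨iK, hiK⟩ := hρK ι
  have hiK2 : iK * iK = algebraMap K _ a := LinearMap.ext fun x => by
    rw [Module.End.mul_apply, hiK, hiK, ← Module.End.mul_apply, ← hρmul, hι, Module.algebraMap_end_apply, hsmulK]
  -- adjoints over `K`: `ψ_K(ρ(z) x, y) = ψ_K(x, ρ(z^ros) y)` (transfer along the trace)
  have hpair : ∀ (z : B.endAlgebra) (T : bettiCohomology B.X 1 →ₗ[K] bettiCohomology B.X 1), (∀ x, T x = ρ z x) →
      ∀ x y, ψK (T x) y = ψK x ((ρ (AbelianVariety.rosati B exists_isReal_hodgeModel_holds hodgePQ_independent_of_hodgeModel_holds ψ z)) y) := by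
    intro z T hT
    obtain ⟨S, hS⟩ := hρK (AbelianVariety.rosati B exists_isReal_hodgeModel_holds hodgePQ_independent_of_hodgeModel_holds ψ z)
    have h := (TraceFormDescent.isAdjointPair_iff_of_trace hψK T S).1 fun x y => by
      have e1 := ψ.form_apply_adjoint (ρ z) x y
      rw [hτρ] at e1
      rw [hT, hS]
      exact e1.symm
    intro x y
    rw [h, hS]
  have hiKskew : ψK.IsSkewAdjoint iK := fun x y => by
    rw [Pi.neg_apply, hpair ι iK hiK x y, hrosι, hρneg, LinearMap.neg_apply, hiK, map_neg]
  -- every element of `Lef(ψ)` is `K`-linear, commutes with `i, j` and is `ψ_K`-skew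
  obtain ⟨MK, hMK⟩ : ∃ MK : Submodule K (bettiCohomology B.X 1 →ₗ[K] bettiCohomology B.X 1), MK =
      Subalgebra.toSubmodule (Subalgebra.centralizer K ({iK} : Set (bettiCohomology B.X 1 →ₗ[K] bettiCohomology B.X 1))) ⊓
        ψK.skewAdjointSubmodule := ⟨_, rfl⟩
  have hlift : ∀ Y ∈ Lef, ∃ T : bettiCohomology B.X 1 →ₗ[K] bettiCohomology B.X 1, (∀ x, T x = Y x) ∧ T ∈ MK := by
    intro Y hY
    have hcommY : ∀ z, Y * ρ z = ρ z * Y := fun z => ((hmemLef.1 hY).1 (ρ z) (hρA z)).symm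
    obtain ⟨T, hT⟩ : ∃ T : bettiCohomology B.X 1 →ₗ[K] bettiCohomology B.X 1, ∀ x, T x = Y x :=
      ⟨{ toFun := Y, map_add' := map_add Y, map_smul' := fun c x => by
          rw [RingHom.id_apply, hsmulK, hsmulK, ← Module.End.mul_apply, hcommY, Module.End.mul_apply] }, fun x => rfl⟩
    refine ⟨T, hT, ?_⟩
    rw [hMK]
    refine Submodule.mem_inf.2 ⟨?_, ?_⟩
    · rw [Subalgebra.mem_toSubmodule, Subalgebra.mem_centralizer_iff]
      intro g hg
      rw [Set.mem_singleton_iff] at hg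
      subst hg
      refine LinearMap.ext fun x => ?_
      rw [Module.End.mul_apply, Module.End.mul_apply, hT, hiK, hiK, hT, ← Module.End.mul_apply, ← hcommY ι,
        Module.End.mul_apply]
    · rw [LinearMap.mem_skewAdjointSubmodule]
      have h := (TraceFormDescent.isAdjointPair_iff_of_trace hψK T (-T)).1 fun x y => by
        rw [hT, LinearMap.neg_apply, hT, map_neg]
        exact (hmemLef.1 hY).2 x y
      intro x y
      rw [Pi.neg_apply, h x y, LinearMap.neg_apply]
  -- conversely, every element of `M_K` restricts to an element of `Lef(ψ)` (`End_Hdg = ρ(End⁰B)`, `End⁰B = K⟨1, i, j, ij⟩`)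
  have hdesc : ∀ T ∈ MK, (T.restrictScalars ℚ : Module.End ℚ (bettiCohomology B.X 1)) ∈ Lef := by
    intro T hTM
    rw [hMK, Submodule.mem_inf, Subalgebra.mem_toSubmodule, Subalgebra.mem_centralizer_iff, LinearMap.mem_skewAdjointSubmodule] at hTM
    obtain ⟨hTc, hTs⟩ := hTM
    have hTi : ∀ x, T (iK x) = iK (T x) := fun x => by
      rw [← Module.End.mul_apply, ← hTc iK (by simp), Module.End.mul_apply]
    -- `T` commutes with `ρ(z)` for every `z ∈ End⁰B`
    have hPK : ∀ c : K, ∀ x, T (ρ (algebraMap K _ c) x) = ρ (algebraMap K _ c) (T x) := fun c x => by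
      rw [← hsmulK, ← hsmulK, map_smul]
    have hPmul : ∀ z w : B.endAlgebra, (∀ x, T (ρ z x) = ρ z (T x)) → (∀ x, T (ρ w x) = ρ w (T x)) →
        ∀ x, T (ρ (z * w) x) = ρ (z * w) (T x) := fun z w hz hw x => by
      rw [hρmul, Module.End.mul_apply, Module.End.mul_apply, hw, hz]
    have hPadd : ∀ z w : B.endAlgebra, (∀ x, T (ρ z x) = ρ z (T x)) → (∀ x, T (ρ w x) = ρ w (T x)) →
        ∀ x, T (ρ (z + w) x) = ρ (z + w) (T x) := fun z w hz hw x => by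
      rw [hρadd, LinearMap.add_apply, LinearMap.add_apply, map_add, hz, hw]
    have hPi : ∀ x, T (ρ ι x) = ρ ι (T x) := fun x => by rw [← hiK, ← hiK, hTi]
    have hP : ∀ z : B.endAlgebra, ∀ x, T (ρ z x) = ρ z (T x) := fun z => by
      obtain ⟨c, d, rfl⟩ := hgen z
      exact hPadd _ _ (hPK c) (hPmul _ _ (hPK d) hPi)
    refine hmemLef.2 ⟨fun g hg => ?_, fun x y => ?_⟩
    · obtain ⟨z, hz⟩ := exists_unop_bettiRep_eq_of_mem_endAlg (AbelianVariety.isSmoothProjective_holds (A := B)) hg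
      refine LinearMap.ext fun x => ?_
      rw [Module.End.mul_apply, Module.End.mul_apply, LinearMap.restrictScalars_apply, LinearMap.restrictScalars_apply, ← hz,
        ← hρ, hP]
    · have h := (TraceFormDescent.isAdjointPair_iff_of_trace hψK T (-T)).2 fun x y => by
        rw [LinearMap.neg_apply, ← Pi.neg_apply (T : bettiCohomology B.X 1 → bettiCohomology B.X 1) y]; exact hTs x y
      rw [LinearMap.restrictScalars_apply, LinearMap.restrictScalars_apply, h, LinearMap.neg_apply, map_neg]
  -- the two `ℚ`-linear injections `Lef(ψ) ↪ M_K ↪ Lef(ψ)`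
  choose T hT hTmem using hlift
  let Φ : Lef →ₗ[ℚ] MK :=
    { toFun := fun Y => ⟨T Y Y.2, hTmem Y Y.2⟩
      map_add' := fun Y Y' => Subtype.ext (LinearMap.ext fun x => by
        change T _ (Y + Y').2 x = T Y Y.2 x + T Y' Y'.2 x
        rw [hT, hT, hT]
        rfl)
      map_smul' := fun r Y => Subtype.ext (LinearMap.ext fun x => by
        change T _ (r • Y).2 x = r • T Y Y.2 x
        rw [hT, hT]
        rfl) }
  have hΦ : Function.Injective Φ := by
    intro Y Y' h
    apply Subtype.ext
    refine LinearMap.ext fun x => ?_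
    have h' : T Y Y.2 = T Y' Y'.2 := congrArg Subtype.val h
    rw [← hT Y Y.2, ← hT Y' Y'.2, h']
  let Ψ : MK →ₗ[ℚ] Lef :=
    { toFun := fun S => ⟨(S : bettiCohomology B.X 1 →ₗ[K] bettiCohomology B.X 1).restrictScalars ℚ, hdesc S S.2⟩
      map_add' := fun S S' => rfl
      map_smul' := fun r S => rfl }
  have hΨ : Function.Injective Ψ := by
    intro S S' h
    apply Subtype.ext
    refine LinearMap.ext fun x => ?_
    exact LinearMap.congr_fun (congrArg Subtype.val h) x
  haveI : Module.Finite K MK := inferInstance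
  haveI : Module.Finite ℚ MK := Module.Finite.trans K MK
  have hLefMK : Module.finrank ℚ Lef = Module.finrank ℚ K * Module.finrank K MK := by
    rw [Module.finrank_mul_finrank ℚ K MK]
    exact le_antisymm (LinearMap.finrank_le_finrank_of_injective hΦ) (LinearMap.finrank_le_finrank_of_injective hΨ)
  -- the same restriction of scalars for the full centraliser: `C(End_Hdg) = Res_{K/ℚ} C_K(ι)`
  obtain ⟨Cq, hCq⟩ : ∃ Cq : Submodule ℚ (Module.End ℚ (bettiCohomology B.X 1)), Cq =
      Subalgebra.toSubmodule (Subalgebra.centralizer ℚ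
        ((BettiUniverse.hodge exists_isReal_hodgeModel_holds (AbelianVariety.isSmoothProjective_holds (A := B)) 1).endAlg :
          Set (Module.End ℚ (bettiCohomology B.X 1)))) := ⟨_, rfl⟩
  have hmemCq : ∀ {Y : Module.End ℚ (bettiCohomology B.X 1)}, Y ∈ Cq ↔
      ∀ g ∈ (BettiUniverse.hodge exists_isReal_hodgeModel_holds (AbelianVariety.isSmoothProjective_holds (A := B)) 1).endAlg,
        g * Y = Y * g := fun {Y} => by
    rw [hCq, Subalgebra.mem_toSubmodule, Subalgebra.mem_centralizer_iff]
    exact Iff.rfl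
  obtain ⟨CK, hCK⟩ : ∃ CK : Submodule K (bettiCohomology B.X 1 →ₗ[K] bettiCohomology B.X 1), CK =
      Subalgebra.toSubmodule (Subalgebra.centralizer K ({iK} : Set (bettiCohomology B.X 1 →ₗ[K] bettiCohomology B.X 1))) :=
    ⟨_, rfl⟩
  have hlift' : ∀ Y ∈ Cq, ∃ T : bettiCohomology B.X 1 →ₗ[K] bettiCohomology B.X 1, (∀ x, T x = Y x) ∧ T ∈ CK := by
    intro Y hY
    have hcommY : ∀ z, Y * ρ z = ρ z * Y := fun z => ((hmemCq.1 hY) (ρ z) (hρA z)).symm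
    obtain ⟨T, hT⟩ : ∃ T : bettiCohomology B.X 1 →ₗ[K] bettiCohomology B.X 1, ∀ x, T x = Y x :=
      ⟨{ toFun := Y, map_add' := map_add Y, map_smul' := fun c x => by
          rw [RingHom.id_apply, hsmulK, hsmulK, ← Module.End.mul_apply, hcommY, Module.End.mul_apply] }, fun x => rfl⟩
    refine ⟨T, hT, ?_⟩
    rw [hCK, Subalgebra.mem_toSubmodule, Subalgebra.mem_centralizer_iff]
    intro g hg
    rw [Set.mem_singleton_iff] at hg
    subst hg
    refine LinearMap.ext fun x => ?_
    rw [Module.End.mul_apply, Module.End.mul_apply, hT, hiK, hiK, hT, ← Module.End.mul_apply, ← hcommY ι, Module.End.mul_apply]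
  have hdesc' : ∀ T ∈ CK, (T.restrictScalars ℚ : Module.End ℚ (bettiCohomology B.X 1)) ∈ Cq := by
    intro T hTM
    rw [hCK, Subalgebra.mem_toSubmodule, Subalgebra.mem_centralizer_iff] at hTM
    have hTi : ∀ x, T (iK x) = iK (T x) := fun x => by
      rw [← Module.End.mul_apply, ← hTM iK (by simp), Module.End.mul_apply]
    have hPK : ∀ c : K, ∀ x, T (ρ (algebraMap K _ c) x) = ρ (algebraMap K _ c) (T x) := fun c x => by
      rw [← hsmulK, ← hsmulK, map_smul]
    have hPmul : ∀ z w : B.endAlgebra, (∀ x, T (ρ z x) = ρ z (T x)) → (∀ x, T (ρ w x) = ρ w (T x)) →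
        ∀ x, T (ρ (z * w) x) = ρ (z * w) (T x) := fun z w hz hw x => by
      rw [hρmul, Module.End.mul_apply, Module.End.mul_apply, hw, hz]
    have hPadd : ∀ z w : B.endAlgebra, (∀ x, T (ρ z x) = ρ z (T x)) → (∀ x, T (ρ w x) = ρ w (T x)) →
        ∀ x, T (ρ (z + w) x) = ρ (z + w) (T x) := fun z w hz hw x => by
      rw [hρadd, LinearMap.add_apply, LinearMap.add_apply, map_add, hz, hw]
    have hPi : ∀ x, T (ρ ι x) = ρ ι (T x) := fun x => by rw [← hiK, ← hiK, hTi]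
    have hP : ∀ z : B.endAlgebra, ∀ x, T (ρ z x) = ρ z (T x) := fun z => by
      obtain ⟨c, d, rfl⟩ := hgen z
      exact hPadd _ _ (hPK c) (hPmul _ _ (hPK d) hPi)
    refine hmemCq.2 fun g hg => ?_
    obtain ⟨z, hz⟩ := exists_unop_bettiRep_eq_of_mem_endAlg (AbelianVariety.isSmoothProjective_holds (A := B)) hg
    refine LinearMap.ext fun x => ?_
    rw [Module.End.mul_apply, Module.End.mul_apply, LinearMap.restrictScalars_apply, LinearMap.restrictScalars_apply, ← hz,
      ← hρ, hP]
  choose T' hT' hT'mem using hlift'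
  let Φ' : Cq →ₗ[ℚ] CK :=
    { toFun := fun Y => ⟨T' Y Y.2, hT'mem Y Y.2⟩
      map_add' := fun Y Y' => Subtype.ext (LinearMap.ext fun x => by
        change T' _ (Y + Y').2 x = T' Y Y.2 x + T' Y' Y'.2 x
        rw [hT', hT', hT']
        rfl)
      map_smul' := fun r Y => Subtype.ext (LinearMap.ext fun x => by
        change T' _ (r • Y).2 x = r • T' Y Y.2 x
        rw [hT', hT']
        rfl) }
  have hΦ' : Function.Injective Φ' := by
    intro Y Y' h
    apply Subtype.ext
    refine LinearMap.ext fun x => ?_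
    have h' : T' Y Y.2 = T' Y' Y'.2 := congrArg Subtype.val h
    rw [← hT' Y Y.2, ← hT' Y' Y'.2, h']
  let Ψ' : CK →ₗ[ℚ] Cq :=
    { toFun := fun S => ⟨(S : bettiCohomology B.X 1 →ₗ[K] bettiCohomology B.X 1).restrictScalars ℚ, hdesc' S S.2⟩
      map_add' := fun S S' => rfl
      map_smul' := fun r S => rfl }
  have hΨ' : Function.Injective Ψ' := by
    intro S S' h
    apply Subtype.ext
    refine LinearMap.ext fun x => ?_
    exact LinearMap.congr_fun (congrArg Subtype.val h) x
  haveI : Module.Finite K CK := inferInstance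
  haveI : Module.Finite ℚ CK := Module.Finite.trans K CK
  have hCqCK : Module.finrank ℚ Cq = Module.finrank ℚ K * Module.finrank K CK := by
    rw [Module.finrank_mul_finrank ℚ K CK]
    exact le_antisymm (LinearMap.finrank_le_finrank_of_injective hΦ') (LinearMap.finrank_le_finrank_of_injective hΨ')
  -- the unitary count over `K`
  have hcount := UnitaryCentralizerForm.two_mul_finrank_centralizer_inf_skewAdjoint ψK hψKnd hψKflip ha hiK2 hiKskew
  rw [← hMK, ← hCK] at hcount
  rw [← hCq, hLefMK, hCqCK, ← hcount]
  ring

variable [HodgeTensorFacts.{0, 0}]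

/-- **`2 · dim Lie Hg(H¹B) ≤ dim C(End_Hdg(H¹B))`** in the situation of
`two_mul_finrank_lefschetz_eq_finrank_centralizer_of_cmCentre` (`Hg ⊆ U`: the Hodge Lie algebra lies in the unitary Lefschetz
Lie algebra). [cite: MoonenZarhin1999LowDim, §1] [cite: Milne1999LefschetzClasses, §2 and Summary] -/
theorem two_mul_finrank_hodgeLie_le_finrank_centralizer_of_cmCentre {B : AbelianVariety ℂ} {K : Type} [Field K] [NumberField K]
    [IsTotallyReal K] [Algebra K B.endAlgebra] [IsScalarTower ℚ K B.endAlgebra] [Module.Finite ℚ (bettiCohomology B.X 1)]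
    (ψ : (BettiUniverse.hodge exists_isReal_hodgeModel_holds (AbelianVariety.isSmoothProjective_holds (A := B)) 1).Polarization)
    {ι : B.endAlgebra} {a : K} (ha : a ≠ 0) (hι : ι * ι = algebraMap K B.endAlgebra a)
    (hgen : ∀ z : B.endAlgebra, ∃ c d : K, z = algebraMap K _ c + algebraMap K _ d * ι)
    (hrosK : ∀ c : K, AbelianVariety.rosati B exists_isReal_hodgeModel_holds hodgePQ_independent_of_hodgeModel_holds ψ
      (algebraMap K _ c) = algebraMap K _ c)
    (hrosι : AbelianVariety.rosati B exists_isReal_hodgeModel_holds hodgePQ_independent_of_hodgeModel_holds ψ ι = -ι) :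
    2 * Module.finrank ℚ
        (BettiUniverse.hodge exists_isReal_hodgeModel_holds (AbelianVariety.isSmoothProjective_holds (A := B)) 1).hodgeLie ≤
      Module.finrank ℚ ↥(Subalgebra.toSubmodule (Subalgebra.centralizer ℚ
          ((BettiUniverse.hodge exists_isReal_hodgeModel_holds (AbelianVariety.isSmoothProjective_holds (A := B)) 1).endAlg :
            Set (Module.End ℚ (bettiCohomology B.X 1))))) := by
  rw [← two_mul_finrank_lefschetz_eq_finrank_centralizer_of_cmCentre ψ ha hι hgen hrosK hrosι]
  exact Nat.mul_le_mul_left 2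
    (Submodule.finrank_mono (hodgeLie_hodge_one_le_lefschetz (AbelianVariety.isSmoothProjective_holds (A := B)) ψ))

end Summit.HodgeConjecture.CorCM

end
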